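import Summits.MatrixMultiplication.OmegaCensus.SmallFormats.EtaSpecialFinTwo
import HarnessLib

/-!
# ω-census family (a): a functional with an η-KILLED LINE component cannot kill the `Z`-outputs — kernel form of desk law §8(c)

Cell `pub-omega` (unit `pub-omega-tensor-g26`), topic `Summits/MatrixMultiplication/OmegaCensus` (sub-folder `SmallFormats`).
Framing (verbatim): lottery ticket; floor = certified bounds/negative ranges. HONEST FRAMING: an elementary structural no-go over an arbitrary
field (`m = 2`), the kernel form of desk law §8(c) of `NEAR-STRUCTURE.md` (tensor g25) — the last of the structural cuts of the tensor ω-engine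
(`kitjob-nearomega2/3`) that was not yet a theorem of the tree ((i) p504441, (v) p501624, (a) p523443, (b) p519828). No rank bound; nothing on `ω`.

**Statement (`near_not_kill_eta_line`).** Near-frame point of `⟨2,2,n⟩` (`X₀ = 1`, frame data `ρ, σ, l, j₀` of `InvertiblePointNearFrame`), a line
column `q` with direction `ζ` carried by every `W_t` (`t ∉ O`) and by `W_{j₀}`, a functional `η ≠ 0` on `k²` with `η(ζ) = 0`, a functional `μ` with
`μ(ζ) = 1`, a scalar `c ≠ 0` and any `b̂ ∈ kⁿ`. Put `ω̂(W) := η(W b̂) + c·μ(W e_q)`. If `ω̂(W_t) = 0` for all `t ∉ O` and EITHER `ω̂(W_{j₀}) = 0` ('case A')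
OR the removed class `c_{j₀}` is η-special ('case B'), contradiction. Proof (§8(c)): column `q` of the reduced footprint identity (`nearBasis_footprint_eq`,
p493611) read through `η` shows that a reduced basis vector with nonzero `q`-column `v_s` has `c_s = η(· u_s)`; the ω-law (`omega_law_of_forall`,
p513166) for `ω̂` then writes the rank-one functional `c·μ(· v_s)` as an η-special one, and evaluating at `X = ζ λᵀ` gives `v_s = 0`; so every
output `W_i` has its `q`-column on `k ζ`, contradicting `Y = Σ_{s∈O} f_s(1) g_s(Y) W_s` (`eq_sum_off_one`) for `Y = w e_qᵀ` with `η(w) = 1`.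
-/

namespace Summit.MatrixMultiplication.OmegaCensus.SmallFormats

open Module Matrix Literature.Computability.AlgebraicComplexity

variable {k : Type*} [Field k] {n : ℕ} {ι : Type*} [Fintype ι]

section LineKill

variable (β : BilinComp (mulBilin k 2 2 n) ι) (O : Finset ι)

/-- **Law §8(c) of `NEAR-STRUCTURE.md`, kernel form (tensor g26).** See the module docstring. The engine's cut: an ω with rank-one free part
`η ⊗ b` (or `b = 0`) plus a nonzero component on exactly one line column whose direction `η` kills is DEAD in case A for every removed class and in
case B when the removed class is η-special. -/
theorem near_not_kill_eta_line [DecidableEq ι] (hO : ∀ i, i ∉ O → β.f i 1 = 0) (hO' : ∀ i ∈ O, β.f i 1 ≠ 0) {ρ σ l : ι → k}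
    (hM : ∀ s ∈ O, ∀ j ∈ O, β.f s 1 * β.g s (β.w j) = (if s = j then 1 else 0) + ρ s * σ j)
    {j₀ : ι} (hj₀ : j₀ ∈ O) (hl : ∀ s ∈ O, σ s = l s * σ j₀)
    (q : Fin n) (ζ : Fin 2 → k) (hT : ∀ t, t ∉ O → ∃ a : k, ∀ r, β.w t r q = a * ζ r) (w₀ : k) (hQ : ∀ r, β.w j₀ r q = w₀ * ζ r)
    (η : Module.Dual k (Fin 2 → k)) (hη : η ≠ 0) (hηζ : η ζ = 0) (μ : Module.Dual k (Fin 2 → k)) (hμζ : μ ζ = 1)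
    (c : k) (hc : c ≠ 0) (bh : Fin n → k)
    (hv : ∀ t, t ∉ O → η (β.w t *ᵥ bh) + c * μ (β.w t *ᵥ Pi.single q 1) = 0)
    (hcase : η (β.w j₀ *ᵥ bh) + c * μ (β.w j₀ *ᵥ Pi.single q 1) = 0 ∨
      ∃ u₀ : Fin 2 → k, ∀ X, β.f j₀ X * (β.f j₀ 1)⁻¹ = η (X *ᵥ u₀)) : False := by
  obtain ⟨wη, hwη⟩ := exists_apply_eq_one_of_ne_zero η hη
  set eq : Fin n → k := Pi.single q 1 with heq
  -- columns `q` of `W_t` (`t ∉ O`) and `W_{j₀}` lie on the line `k ζ`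
  have hcol : ∀ W : Matrix (Fin 2) (Fin n) k, ∀ r, (W *ᵥ eq) r = W r q := fun W r => by
    simp [heq, Matrix.mulVec, dotProduct, Pi.single_apply]
  have hcolT : ∀ t, t ∉ O → ∃ a : k, β.w t *ᵥ eq = a • ζ := by
    intro t ht
    obtain ⟨a, ha⟩ := hT t ht
    exact ⟨a, funext fun r => by rw [hcol, ha r, Pi.smul_apply, smul_eq_mul]⟩
  have hcolQ : β.w j₀ *ᵥ eq = w₀ • ζ := funext fun r => by
    rw [hcol, hQ r, Pi.smul_apply, smul_eq_mul]
  -- `W ↦ η(W e_q)` as a linear map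
  have hLη : ∀ W : Matrix (Fin 2) (Fin n) k, (η.comp ((Matrix.mulVecBilin k k).flip eq)) W = η (W *ᵥ eq) :=
    fun W => eta_comp_mulVec_apply η eq W
  -- the functional `ω̂`
  let ω : Module.Dual k (Matrix (Fin 2) (Fin n) k) :=
    η.comp ((Matrix.mulVecBilin k k).flip bh) + c • μ.comp ((Matrix.mulVecBilin k k).flip eq)
  have hωapp : ∀ W, ω W = η (W *ᵥ bh) + c * μ (W *ᵥ eq) := fun W => by
    simp [ω, Matrix.mulVecBilin_apply]
  have hω : ∀ t, t ∉ O → ω (β.w t) = 0 := fun t ht => by rw [hωapp]; exact hv t ht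
  -- evaluation matrices: `η((ζ λᵀ) z) = 0`, `μ((ζ λᵀ) v) = λ·v`
  have hζX : ∀ lam z : Fin 2 → k, η (vecMulVec ζ lam *ᵥ z) = 0 := fun lam z => by
    rw [vecMulVec_mulVec_eq_smul, map_smul, hηζ, smul_zero]
  have hμX : ∀ lam v : Fin 2 → k, μ (vecMulVec ζ lam *ᵥ v) = lam ⬝ᵥ v := fun lam v => by
    rw [vecMulVec_mulVec_eq_smul, map_smul, hμζ, smul_eq_mul, mul_one]
  -- MAIN STEP: every reduced basis vector has zero `q`-column
  have hv0 : ∀ s ∈ O, s ≠ j₀ → (β.w s - l s • β.w j₀) *ᵥ eq = 0 := by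
    intro s hs hsj
    set v : Fin 2 → k := (β.w s - l s • β.w j₀) *ᵥ eq with hvdef
    have hfp := nearBasis_footprint_eq β O hO' hM hj₀ hs (hl s hs) 
    -- (1) column `q` of the footprint identity, read through `η`: `η(X v) = c_s(X) η(v)`
    have h1 : ∀ X : Matrix (Fin 2) (Fin 2) k, η (X *ᵥ v) = β.f s X * (β.f s 1)⁻¹ * η v := by
      intro X
      have h := congrArg (fun W : Matrix (Fin 2) (Fin n) k => (η.comp ((Matrix.mulVecBilin k k).flip eq)) W) (hfp X)
      simp only [map_sub, map_smul, map_add, map_sum, smul_eq_mul] at h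
      simp only [hLη] at h
      have hZ : ∑ x ∈ Finset.univ \ O, β.f x X * (β.g x (β.w s) - l s * β.g x (β.w j₀)) * η (β.w x *ᵥ eq) = 0 :=
        Finset.sum_eq_zero fun t ht => by
          obtain ⟨a, ha⟩ := hcolT t (Finset.mem_sdiff.mp ht).2
          rw [ha, map_smul, hηζ, smul_zero, mul_zero]
      have hQ0 : η (β.w j₀ *ᵥ eq) = 0 := by rw [hcolQ, map_smul, hηζ, smul_zero]
      have hv' : η v = η (β.w s *ᵥ eq) - l s * η (β.w j₀ *ᵥ eq) := by
        rw [hvdef, Matrix.sub_mulVec, Matrix.smul_mulVec, map_sub, map_smul, smul_eq_mul]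
      have hXv : η (X *ᵥ v) = η ((X * (β.w s - l s • β.w j₀)) *ᵥ eq) := by rw [hvdef, Matrix.mulVec_mulVec]
      rw [hZ, hQ0] at h
      rw [hXv, hv', hQ0]
      linear_combination h
    -- (2) the ω-law for `ω̂`
    have h2 : ∀ X : Matrix (Fin 2) (Fin 2) k,
        η (X *ᵥ ((β.w s - l s • β.w j₀) *ᵥ bh)) + c * μ (X *ᵥ v) - β.f s X * (β.f s 1)⁻¹ * ω (β.w s - l s • β.w j₀) =
          ω (β.w j₀) * (l s * (β.f s X * (β.f s 1)⁻¹ - β.f j₀ X * (β.f j₀ 1)⁻¹)) := by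
      intro X
      have h := omega_law_of_forall β O hO' hM hj₀ hs (hl s hs) X ω hω
      rw [hωapp (X * _), ← Matrix.mulVec_mulVec, ← Matrix.mulVec_mulVec, ← hvdef] at h
      exact h
    by_contra hvne
    -- `η(v) ≠ 0` (else `η(X v) = 0` for all `X`, forcing `v = 0`), so `c_s(X) = η(X v)/η(v)`
    have hηv : η v ≠ 0 := by
      intro h0
      apply hvne
      funext i
      have h := h1 (vecMulVec wη (Pi.single i 1))
      rw [h0, mul_zero, eta_vecMulVec_single_mulVec η hwη] at h
      rw [h, Pi.zero_apply]
    -- evaluate the ω-law at `X = ζ λᵀ`: all η-terms vanish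
    have h3 : ∀ lam : Fin 2 → k, c * (lam ⬝ᵥ v) = 0 := by
      intro lam
      have hX1 : β.f s (vecMulVec ζ lam) * (β.f s 1)⁻¹ = 0 := by
        have h := h1 (vecMulVec ζ lam)
        rw [hζX] at h
        rcases mul_eq_zero.mp h.symm with h' | h'
        · exact h'
        · exact absurd h' hηv
      have h := h2 (vecMulVec ζ lam)
      rw [hζX, hμX, hX1, zero_mul, zero_add, sub_zero, zero_sub] at h
      -- `h : c (λ·v) = ω(W_{j₀}) (l_s (−c_p(ζλᵀ)))`; the right side vanishes in both cases
      rcases hcase with hA | ⟨u₀, hu₀⟩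
      · rw [← hωapp] at hA
        rw [hA, zero_mul] at h
        exact h
      · rw [hu₀, hζX, neg_zero, mul_zero, mul_zero] at h
        exact h
    apply hvne
    funext i
    have h := h3 (Pi.single i 1)
    rw [single_dotProduct, one_mul] at h
    rcases mul_eq_zero.mp h with h' | h'
    · exact absurd h' hc
    · rw [h', Pi.zero_apply]
  -- hence every `W_s`, `s ∈ O`, has its `q`-column on `k ζ`
  have hcolO : ∀ s ∈ O, η (β.w s *ᵥ eq) = 0 := by
    intro s hs
    by_cases hsj : s = j₀
    · rw [hsj, hcolQ, map_smul, hηζ, smul_zero]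
    · have h := hv0 s hs hsj
      rw [Matrix.sub_mulVec, Matrix.smul_mulVec, sub_eq_zero] at h
      rw [h, map_smul, hcolQ, map_smul, hηζ, smul_zero, smul_zero]
  -- but `Y := wη e_qᵀ` has `q`-column `wη` with `η(wη) = 1`, and `Y = Σ_{s∈O} f_s(1) g_s(Y) W_s`
  set Y : Matrix (Fin 2) (Fin n) k := vecMulVec wη eq with hY
  have hYq : Y *ᵥ eq = wη := by
    rw [hY]
    funext r
    simp [Matrix.mulVec, dotProduct, vecMulVec_apply, heq, Pi.single_apply]
  have hsum := eq_sum_off_one β O hO Y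
  have h := congrArg (fun W : Matrix (Fin 2) (Fin n) k => (η.comp ((Matrix.mulVecBilin k k).flip eq)) W) hsum
  simp only [map_sum, map_smul, smul_eq_mul] at h
  simp only [hLη] at h
  rw [hYq, hwη, Finset.sum_eq_zero fun s hs => by rw [hcolO s hs, mul_zero]] at h
  exact one_ne_zero h

end LineKill

end Summit.MatrixMultiplication.OmegaCensus.SmallFormats
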